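import Summits.BirchSwinnertonDyer.BirchSwinnertonDyer.Theorems.ByReductionTypeAtTwoOrdKatoHalfAtTwoIsoPortRealPlace
import Literature.NumberTheory.EllipticCurves.FineSelmerStatementATotallyComplexProofs
import Literature.NumberTheory.IwasawaTheory.ClassicalMuVanishesUnramifiedClassesProofs
import HarnessLib

/-!
# Route ByReductionTypeAtTwo, crux `OrdKatoHalfAtTwoIso` (stmt-BirchSwinnertonDyer-19573), child B7′ (stmt-BirchSwinnertonDyer-23921):
# the ARCHIMEDEAN step of statement (A) at `2` over `ℚ` — `H¹(Gal(ℚ̄/ℚ_∞) ∩ D_∞, E[2]) = 0` when `Δ_E < 0` — and statement (A) at `2`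
# in `Sel₀[2]`-form from FERRERO–WASHINGTON ALONE for curves with `Δ < 0` and an abelian, totally complex `2`-division field
# (theorems only)

Seat `cruxlead-stmt-BirchSwinnertonDyer-19573-w2` GEN 3 (prover WIDTH under LEAD cruxlead-19573 g5; HOME `run/shared/lean/pub/bsd-2adic/`;
`--supports` stmt-BirchSwinnertonDyer-23921). HONEST FRAMING (cell bsd-2adic): BSD is not proved by any of this; neither the crux nor B7′ is
proved here; THEOREMS ONLY, the one remaining named fact (Ferrero–Washington, `IwasawaTheory.ferreroWashington1979_classicalMuVanishes`)
displayed.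

WHY THIS FILE. The lane's Literature file `FineSelmerStatementATotallyComplexProofs` (p694876) proves statement (A) at ANY `p` in
Greenberg's `Sel₀[p]`-form from (i) the character form of Iwasawa's `μ = 0` (`classicalMuVanishes_finite_unramifiedClasses` — NOW A TREE
THEOREM incl. `p = 2` with a totally complex field, `classicalMuVanishes_finite_unramifiedClasses_holds`, bsd-potss-rkm g34 p694611),
(ii) `ClassicalMuVanishes` for the cyclotomic `ℤ_p`-extension of a TOTALLY COMPLEX `K(E[p])` (Ferrero–Washington when it is abelian over
`ℚ`), and (iii) the archimedean vanishing `H¹(Gal(K̄/K_∞) ∩ D_w, E[p]) = 0` at every infinite place. Over `ℚ` at `p = 2`, (iii) holds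
exactly when complex conjugation acts on `E[2]` with `H¹ = 0`, i.e. as a TRANSPOSITION, i.e. `Δ_E < 0` — the line's real-place device
(Δ) (`PortRealPlace`: `discreteH1_eq_zero_of_natCard_le_two_of_ker_le_range` + the slot lemma
`exists_eq_smul_sub_of_add_smul_eq_zero_of_sign_eq_neg_one` + `sign_permGal_eq_neg_one_of_isComplexConjugation_of_Δ_neg`), here
re-run in the `subgroupH1`/`decompInf` idiom of the tree's fine Selmer groups:

* `subgroupH1_geomTorsion_two_inf_decompInf_eq_zero_of_Δ_neg` — (iii) at `p = 2` over `ℚ` for `Δ_E < 0`, for EVERY subgroup `H`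
  (in particular `H = ker κ` of any `ℤ₂`-extension).
* `finite_fineSelmerInfty_twoTorsion_of_ferreroWashington_of_Δ_neg_of_isTotallyComplex` — **`Sel₀(E/ℚ_∞, E[2^∞])[2]` finite from
  Ferrero–Washington ALONE** for every elliptic `W/ℚ` with `Δ_W < 0` whose `2`-division field is abelian and totally complex (e.g.
  `E[2]` reducible with `Δ < 0`: `ℚ(E[2]) = ℚ(√Δ)` imaginary quadratic) — a second, Lim-free road to the (A₂) binder of this lane's
  `μ`-doors on that sub-habitat (the Lim@2 road `…ConjATwoOfNotSurjective` covers the whole habitat modulo Lim 2017 Thm. 3.5 at `2`).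

References: [SerreGaloisCohomology1997] I §2.4; [LimSujatha2018] §3; [CoatesSujatha2005] Thm. 3.4; [Lang1990] Ch. 5 §§1–4;
[FerreroWashington1979]; [GreenbergLNM1716] §1 p. 60, §3; the line's p663xxx `…PortRealPlace`, p694876, p694611.
-/

set_option autoImplicit false
set_option linter.dupNamespace false

noncomputable section

open Field WeierstrassCurve Function NumberField IsDedekindDomain
open scoped NumberField Classical
open Literature.NumberTheory.EllipticCurves Literature.NumberTheory.EllipticCurves.GreenbergSelmer
  Literature.NumberTheory.GaloisRepresentations Literature.NumberTheory.GaloisCohomology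
  Literature.NumberTheory.IwasawaTheory
open Summit.BirchSwinnertonDyer.BirchSwinnertonDyer.Rank1Residual

namespace Summit.BirchSwinnertonDyer.BirchSwinnertonDyer.Theorems.SteinbergFibreAtTwo

/-! ## §1 The archimedean local kernel at `p = 2` over `ℚ` vanishes when `Δ < 0` -/

/-- **`H¹(H ∩ D_w, E[2]) = 0` at the infinite place `w` of `ℚ` when `Δ_E < 0`, for every subgroup `H ≤ Γ_ℚ`.** The group
`H ∩ D_w` is the image of a subgroup of `Γ_ℝ`, of order `≤ 2`; its non-trivial element (if any) is the restriction of complex conjugation,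
a complex conjugation of `Γ_ℚ` at `w` (`isComplexConjugationAt_absGaloisRestrict_of_ne_one`), which acts on `E[2]` as a TRANSPOSITION
since `Δ < 0` (`sign_permGal_eq_neg_one_of_isComplexConjugation_of_Δ_neg`), so `ker(1 + c) = im(c − 1)` on `E[2]` (slot lemma
`exists_eq_smul_sub_of_add_smul_eq_zero_of_sign_eq_neg_one`) and `H¹ = 0` (`discreteH1_eq_zero_of_natCard_le_two_of_ker_le_range`).
This is the `p = 2` replacement, on `Δ < 0`, of the tree's odd-`p` lemma `subgroupH1_geomTorsion_inf_decompInf_eq_zero`.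
[cite: SerreGaloisCohomology1997, I §2.4 (the case G = Gal(ℂ/ℝ))] [cite: SilvermanAEC2009, Cor. III.6.4(b)] -/
theorem subgroupH1_geomTorsion_two_inf_decompInf_eq_zero_of_Δ_neg (W : WeierstrassCurve ℚ) [W.IsElliptic] (hΔ : W.Δ < 0)
    (H : Subgroup (absoluteGaloisGroup ℚ)) (w : InfinitePlace ℚ)
    (y : subgroupH1 (H ⊓ decompInf w) (W.geomTorsion ((2 : ℕ) : ℤ))) : y = 0 := by
  haveI := finite_absoluteGaloisGroup_completion_infinitePlace w
  -- `H ⊓ D_w` is the image of a subset of `Γ_{ℚ_w}`, of order `≤ 2`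
  have hsurj : ∀ g : (H ⊓ decompInf w : Subgroup (absoluteGaloisGroup ℚ)),
      ∃ τ : absoluteGaloisGroup w.Completion, absGaloisRestrict ℚ w.Completion τ = g := fun g ↦
    (Subgroup.mem_inf.mp g.2).2
  choose lift hlift using hsurj
  have hinj : Function.Injective lift := fun g g' h ↦ by
    apply Subtype.ext
    rw [← hlift g, ← hlift g', h]
  haveI : Finite (H ⊓ decompInf w : Subgroup (absoluteGaloisGroup ℚ)) := Finite.of_injective lift hinj
  have hcard : Nat.card (H ⊓ decompInf w : Subgroup (absoluteGaloisGroup ℚ)) ≤ 2 :=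
    (Nat.card_le_card_of_injective lift hinj).trans (natCard_absoluteGaloisGroup_completion_infinitePlace_le_two w)
  have hw : w.IsReal := IsTotallyReal.isReal w
  refine discreteH1_eq_zero_of_natCard_le_two_of_ker_le_range hcard _ (fun g hg m hm => ?_) y
  -- the non-trivial `g` is a complex conjugation at `w`, hence a transposition on `E[2]`
  have hτ : lift g ≠ 1 := by
    intro h1
    apply hg
    apply Subtype.ext
    rw [← hlift g, h1, map_one]
    rfl
  have hc : IsComplexConjugationAt hw ((g : absoluteGaloisGroup ℚ)) := by
    rw [← hlift g]
    exact isComplexConjugationAt_absGaloisRestrict_of_ne_one hw hτ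
  have hsign := sign_permGal_eq_neg_one_of_isComplexConjugation_of_Δ_neg W hc hΔ
  have hm' : m + (g : absoluteGaloisGroup ℚ) • m = 0 := hm
  obtain ⟨q, hq⟩ := exists_eq_smul_sub_of_add_smul_eq_zero_of_sign_eq_neg_one W hsign m hm'
  exact ⟨q, hq⟩

/-! ## §2 Statement (A) at `2` in `Sel₀[2]`-form from Ferrero–Washington alone, on «`Δ < 0`, abelian totally complex `ℚ(E[2])`» -/

/-- **`Sel₀(E/ℚ_∞, E[2^∞])[2]` is finite for every elliptic `W/ℚ` with `Δ_W < 0` whose `2`-division field `ℚ(E[2])` is abelian over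
`ℚ` and totally complex, granted FERRERO–WASHINGTON by name** (e.g. `E[2]` reducible with `Δ < 0`, `ℚ(E[2]) = ℚ(√Δ)` imaginary
quadratic): the lane's Literature road `finite_fineSelmerInfty_pTorsion_of_ferreroWashington_of_isTotallyComplex` (p694876) with the
character form of Iwasawa's `μ = 0` DISCHARGED (`classicalMuVanishes_finite_unramifiedClasses_holds`) and the archimedean vanishing from
§1. The (A₂) binder of the lane's `μ`-doors on that sub-habitat, Lim-free. [cite: FerreroWashington1979, main theorem]
[cite: CoatesSujatha2005, Thm. 3.4 (proof)] [cite: Lang1990, Ch. 5 §§1–4] -/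
theorem finite_fineSelmerInfty_twoTorsion_of_ferreroWashington_of_Δ_neg_of_isTotallyComplex
    (hFW : ferreroWashington1979_classicalMuVanishes) (W : WeierstrassCurve ℚ) [W.IsElliptic] (hΔ : W.Δ < 0)
    (hab : IsAbelianGalois ℚ (W.divisionField 2)) (hF : NumberField.IsTotallyComplex (W.divisionField 2))
    (κ : ZpExtension ℚ 2) (hκ : κ.IsCyclotomic) :
    Set.Finite {s : W.fineSelmerInfty κ | 2 • s = 0} :=
  FineSelmerFiniteOfUnramifiedClasses.finite_fineSelmerInfty_pTorsion_of_ferreroWashington_of_isTotallyComplex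
    ClassicalMuVanishesUnramifiedClasses.classicalMuVanishes_finite_unramifiedClasses_holds hFW W hab hF κ hκ
    (fun w y ↦ subgroupH1_geomTorsion_two_inf_decompInf_eq_zero_of_Δ_neg W hΔ κ.kerSubgroup w y)

end Summit.BirchSwinnertonDyer.BirchSwinnertonDyer.Theorems.SteinbergFibreAtTwo

end
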